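import Mathlib.Analysis.Calculus.FDeriv.Analytic
import Mathlib.Analysis.Analytic.OfScalars
import Mathlib.Analysis.SpecialFunctions.Complex.LogBounds
import Literature.NumberTheory.LFunctions.RiemannXiHadamardProduct
import Literature.NumberTheory.LFunctions.ZetaRealAxis
import HarnessLib

/-!
# RiemannHypothesis / LeeYang — `LeeyangCumulantAlternationXi`, part 1: the even derivatives of
`log ξ` at `½` as power sums over the Hadamard multiset

Route `RiemannHypothesis/LeeYang`, item `stmt-RiemannHypothesis-0456` (`LeeyangCumulantAlternationXi`:
`0 < (−1)^{n+1} (log ξ)^{(2n)}(½)` for `n ≥ 1`).  This file is the ANALYTIC half of the proof.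

Let `b` be a Hadamard sequence of de Bruijn's `H₀` (`Literature.NumberTheory.LFunctions.IsHadamardSeq 0 b`,
which exists by `exists_isHadamardSeq`; the non-zero `bₖ` are the `1/(2ρ−1)²`, `{ρ, 1−ρ}` running over
the pairs of non-trivial zeros of `ζ` with multiplicity).  By the tree's Hadamard product of `ξ`
(`IsHadamardSeq.hasSum_log_norm_factors_sub`), for real `y`

  `log|ξ(½+y)| − log|ξ(½)| = ∑ₖ log|1 − 4bₖy²| = −∑ₖ Re ∑_{m≥1} (4bₖy²)^m/m = −∑_{m≥1} (4^m/m) Re(∑ₖ bₖ^m) y^{2m}`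

for `|y|` small (absolutely convergent double series, `Complex.hasSum_taylorSeries_neg_log`), so the
route's function `σ ↦ log ‖ξ σ‖` on `ℝ` is analytic at `½` with these Taylor coefficients
(`exists_hasFPowerSeriesOnBall_log_norm_riemannXi`) and

  `(log|ξ|)^{(2n)}(½) = −(2n)!·(4ⁿ/n)·Re ∑ₖ bₖⁿ`     (`iteratedDeriv_log_norm_riemannXi_one_half`),

via `HasFPowerSeriesOnBall.factorial_smul`.  The sign of `Re ∑ₖ (−bₖ)ⁿ` (positive: the first zero
`½ ± 14.13i` dominates) is settled in the companion file.  No new definitions.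
-/

noncomputable section

namespace Summit.RiemannHypothesis.LeeYang

open Complex Filter Topology Literature.NumberTheory.LFunctions
open scoped Nat NNReal ENNReal

variable {b : ℕ → ℂ}

/-- `ξ` has no zeros on the real axis (no real zeros of `ζ` in the critical strip,
`riemannZeta_ne_zero_of_im_eq_zero_of_pos_of_lt_one`, and `ξ = 0 ↔` non-trivial zero of `ζ`). -/
theorem riemannXi_ofReal_ne_zero (σ : ℝ) : riemannXi (σ : ℂ) ≠ 0 := by
  intro h
  obtain ⟨hz, h0, h1⟩ := (riemannXi_eq_zero_iff_holds (σ : ℂ)).1 h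
  exact riemannZeta_ne_zero_of_im_eq_zero_of_pos_of_lt_one (Complex.ofReal_im σ) h0 h1 hz

/-- The logarithm of the Hadamard product on the real axis:
`log|ξ(½+y)| − log|ξ(½)| = ∑ₖ log|1 − bₖ·(4y²)|`. -/
theorem hasSum_log_norm_factors_real (hb : IsHadamardSeq 0 b) (y : ℝ) :
    HasSum (fun k ↦ Real.log ‖1 - b k * ((4 * y ^ 2 : ℝ) : ℂ)‖)
      (Real.log ‖riemannXi ((1 / 2 + y : ℝ) : ℂ)‖ - Real.log ‖riemannXi ((1 / 2 : ℝ) : ℂ)‖) := by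
  have h := hb.hasSum_log_norm_factors_sub (riemannXi_ofReal_ne_zero (1 / 2 + y))
    (riemannXi_ofReal_ne_zero (1 / 2))
  have e1 : (2 * ((1 / 2 + y : ℝ) : ℂ) - 1) ^ 2 = ((4 * y ^ 2 : ℝ) : ℂ) := by push_cast; ring
  have e2 : (2 * ((1 / 2 : ℝ) : ℂ) - 1) ^ 2 = 0 := by push_cast; ring
  rw [e1, e2] at h
  simpa only [mul_zero, sub_zero, norm_one, Real.log_one] using h

/-- `Re ∑_{m} w^m/m = −log|1 − w|` for `‖w‖ < 1` (real part of the Taylor series of `−log(1−w)`;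
the `m = 0` term is `0` by `x/0 = 0`). -/
theorem hasSum_re_pow_div_nat {w : ℂ} (hw : ‖w‖ < 1) :
    HasSum (fun m : ℕ ↦ (w ^ m / m).re) (-Real.log ‖1 - w‖) := by
  have h := Complex.hasSum_re (Complex.hasSum_taylorSeries_neg_log hw)
  simpa only [neg_re, log_re] using h

/-- Every term of a Hadamard sequence is bounded by the (finite) sum of norms. -/
theorem norm_le_tsum_norm (hb : IsHadamardSeq 0 b) (k : ℕ) : ‖b k‖ ≤ ∑' j, ‖b j‖ :=
  hb.summable.le_tsum k fun _ _ ↦ norm_nonneg _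

/-- `‖∑ₖ bₖ^m‖ ≤ B^m` with `B = ∑ₖ ‖bₖ‖`, for `m ≥ 1`; and the power sums converge. -/
theorem summable_pow_and_norm_tsum_pow_le (hb : IsHadamardSeq 0 b) {m : ℕ} (hm : 1 ≤ m) :
    Summable (fun k ↦ b k ^ m) ∧ ‖∑' k, b k ^ m‖ ≤ (∑' j, ‖b j‖) ^ m := by
  set B := ∑' j, ‖b j‖ with hB
  have hle : ∀ k, ‖b k ^ m‖ ≤ ‖b k‖ * B ^ (m - 1) := by
    intro k
    rw [norm_pow, ← Nat.sub_add_cancel hm, pow_succ', Nat.add_sub_cancel]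
    gcongr
    exact norm_le_tsum_norm hb k
  have hs' : Summable fun k ↦ ‖b k‖ * B ^ (m - 1) := hb.summable.mul_right _
  have hs : Summable fun k ↦ b k ^ m := hs'.of_norm_bounded hle
  refine ⟨hs, ?_⟩
  calc ‖∑' k, b k ^ m‖ ≤ ∑' k, ‖b k ^ m‖ := norm_tsum_le_tsum_norm hs.norm
    _ ≤ ∑' k, ‖b k‖ * B ^ (m - 1) := hs.norm.tsum_le_tsum hle hs'
    _ = B * B ^ (m - 1) := by rw [tsum_mul_right]
    _ = B ^ m := by rw [← pow_succ', Nat.sub_add_cancel hm]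

/-- **The even power series of `log|ξ|` at `½`**: for `8 (B+1) y² ≤ 1` (`B = ∑ₖ ‖bₖ‖`),
`∑_{m ≥ 1} (4y²)^m/m · Re(∑ₖ bₖ^m) = −(log|ξ(½+y)| − log|ξ(½)|)` (Hadamard product + Taylor series
of `log(1−w)`, Fubini for the absolutely convergent double series). -/
theorem hasSum_log_norm_riemannXi_sub (hb : IsHadamardSeq 0 b) {y : ℝ}
    (hy : 8 * ((∑' j, ‖b j‖) + 1) * y ^ 2 ≤ 1) :
    HasSum (fun m : ℕ ↦ ((4 : ℝ) * y ^ 2) ^ m / m * (∑' k, b k ^ m).re)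
      (-(Real.log ‖riemannXi ((1 / 2 + y : ℝ) : ℂ)‖ - Real.log ‖riemannXi ((1 / 2 : ℝ) : ℂ)‖)) := by
  obtain ⟨B, hB⟩ : ∃ B : ℝ, B = ∑' j, ‖b j‖ := ⟨_, rfl⟩
  have hB0 : 0 ≤ B := hB ▸ tsum_nonneg fun j ↦ norm_nonneg _
  have hbk : ∀ k, ‖b k‖ ≤ B := hB ▸ norm_le_tsum_norm hb
  rw [← hB] at hy
  have hy0 : 0 ≤ y ^ 2 := sq_nonneg y
  have hy2 : 4 * y ^ 2 * B ≤ 1 / 2 := by nlinarith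
  -- the ratios `w k = 4 bₖ y²`
  obtain ⟨w, hw⟩ : ∃ w : ℕ → ℂ, ∀ k, w k = b k * ((4 * y ^ 2 : ℝ) : ℂ) := ⟨_, fun _ ↦ rfl⟩
  have hw_norm : ∀ k, ‖w k‖ = 4 * y ^ 2 * ‖b k‖ := by
    intro k
    rw [hw, norm_mul, Complex.norm_real, Real.norm_eq_abs, abs_of_nonneg (by positivity)]
    ring
  have hw_le : ∀ k, ‖w k‖ ≤ 1 / 2 := fun k ↦ by
    rw [hw_norm]
    calc 4 * y ^ 2 * ‖b k‖ ≤ 4 * y ^ 2 * B := by gcongr; exact hbk k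
      _ ≤ 1 / 2 := hy2
  -- the double family `F (k, m) = Re (w k)^m / m`
  obtain ⟨F, hF⟩ : ∃ F : ℕ × ℕ → ℝ, ∀ p, F p = (w p.1 ^ p.2 / p.2).re := ⟨_, fun _ ↦ rfl⟩
  have hFle : ∀ p : ℕ × ℕ, ‖F p‖ ≤ (8 * y ^ 2 * ‖b p.1‖) * (1 / 2 : ℝ) ^ p.2 := by
    rintro ⟨k, m⟩
    rw [hF]
    rcases Nat.eq_zero_or_pos m with rfl | hm
    · simp only [pow_zero, Nat.cast_zero, div_zero, zero_re, norm_zero, mul_one]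
      positivity
    · calc ‖(w k ^ m / m).re‖ ≤ ‖w k ^ m / m‖ := abs_re_le_norm _
        _ ≤ ‖w k‖ ^ m := by
            rw [norm_div, norm_pow, Complex.norm_natCast]
            exact div_le_self (by positivity) (by exact_mod_cast hm)
        _ = ‖w k‖ * ‖w k‖ ^ (m - 1) := by rw [← pow_succ', Nat.sub_add_cancel hm]
        _ ≤ (4 * y ^ 2 * ‖b k‖) * (1 / 2 : ℝ) ^ (m - 1) := by
            rw [hw_norm]
            gcongr
            · rw [← hw_norm]; exact hw_le k
        _ = (8 * y ^ 2 * ‖b k‖) * (1 / 2 : ℝ) ^ m := by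
            rw [← Nat.sub_add_cancel hm, pow_succ, Nat.add_sub_cancel]
            ring
  have hG : Summable fun p : ℕ × ℕ ↦ (8 * y ^ 2 * ‖b p.1‖) * (1 / 2 : ℝ) ^ p.2 := by
    refine summable_mul_of_summable_norm (f := fun k ↦ 8 * y ^ 2 * ‖b k‖)
      (g := fun m ↦ (1 / 2 : ℝ) ^ m) ?_ ?_
    · simpa only [Real.norm_eq_abs, abs_of_nonneg (by positivity : (0 : ℝ) ≤ 8 * y ^ 2),
        abs_mul, abs_norm] using (hb.summable.mul_left (8 * y ^ 2))
    · simpa only [Real.norm_eq_abs, abs_pow, abs_of_nonneg (by norm_num : (0 : ℝ) ≤ 1 / 2)]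
        using summable_geometric_of_lt_one (by norm_num : (0 : ℝ) ≤ 1 / 2) (by norm_num)
  have hFs : Summable F := hG.of_norm_bounded hFle
  -- rows: `∑_m F(k,m) = −log|1 − w k|`
  have hrow : ∀ k, HasSum (fun m ↦ F (k, m)) (-Real.log ‖1 - w k‖) := by
    intro k
    have h := hasSum_re_pow_div_nat (w := w k) (by linarith [hw_le k])
    refine h.congr_fun fun m ↦ ?_
    rw [hF]
  have h1 : HasSum (fun k ↦ -Real.log ‖1 - w k‖) (∑' p, F p) := hFs.hasSum.prod_fiberwise hrow
  have h1' : ∑' p, F p =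
      -(Real.log ‖riemannXi ((1 / 2 + y : ℝ) : ℂ)‖ - Real.log ‖riemannXi ((1 / 2 : ℝ) : ℂ)‖) := by
    refine h1.unique ?_
    have h := (hasSum_log_norm_factors_real hb y).neg
    refine h.congr_fun fun k ↦ ?_
    rw [hw]
  -- columns: `∑_k F(k,m) = (4y²)^m/m · Re ∑ₖ bₖ^m`
  have hcol : ∀ m, HasSum (fun k ↦ F (k, m)) (((4 : ℝ) * y ^ 2) ^ m / m * (∑' k, b k ^ m).re) := by
    intro m
    rcases Nat.eq_zero_or_pos m with rfl | hm
    · have e : ∀ k, F (k, 0) = 0 := fun k ↦ by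
        rw [hF]; simp only [pow_zero, Nat.cast_zero, div_zero, zero_re]
      simp only [e, pow_zero, Nat.cast_zero, div_zero, zero_mul]
      exact hasSum_zero
    · have hs := (summable_pow_and_norm_tsum_pow_le hb hm).1
      have e : ∀ k, F (k, m) = ((4 : ℝ) * y ^ 2) ^ m / m * (b k ^ m).re := by
        intro k
        have : w k ^ m / m = ((((4 : ℝ) * y ^ 2) ^ m / m : ℝ) : ℂ) * b k ^ m := by
          rw [hw]
          push_cast
          ring
        rw [hF]
        simp only [this, re_ofReal_mul]
      simp only [e]
      exact (Complex.hasSum_re hs.hasSum).mul_left _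
  have h2 : HasSum (fun m : ℕ ↦ ((4 : ℝ) * y ^ 2) ^ m / m * (∑' k, b k ^ m).re) (∑' p, F p) := by
    have h := hFs.prod_symm.hasSum.prod_fiberwise fun m ↦ (hcol m)
    have e : ∑' q : ℕ × ℕ, F q.swap = ∑' p, F p := (Equiv.prodComm ℕ ℕ).tsum_eq F
    rwa [e] at h
  rwa [h1'] at h2

/-- **`log|ξ|` is real-analytic at `½`** with Taylor coefficients `a₀ = log|ξ(½)|`,
`a_{2m} = −(4^m/m)·Re ∑ₖ bₖ^m` (`m ≥ 1`), `a_{2m+1} = 0` (radius `≥ 1/(8(B+1))`, `B = ∑ₖ ‖bₖ‖`). -/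
theorem exists_hasFPowerSeriesOnBall_log_norm_riemannXi (hb : IsHadamardSeq 0 b) :
    ∃ (a : ℕ → ℝ) (r : ℝ≥0∞), HasFPowerSeriesOnBall (fun σ : ℝ ↦ Real.log ‖riemannXi (σ : ℂ)‖)
      (FormalMultilinearSeries.ofScalars ℝ a) (1 / 2) r ∧
      ∀ m, 1 ≤ m → a (2 * m) = -((4 : ℝ) ^ m / m) * (∑' k, b k ^ m).re := by
  obtain ⟨B, hB⟩ : ∃ B : ℝ, B = ∑' j, ‖b j‖ := ⟨_, rfl⟩
  have hB0 : 0 ≤ B := hB ▸ tsum_nonneg fun j ↦ norm_nonneg _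
  obtain ⟨L0, hL0⟩ : ∃ L0 : ℝ, L0 = Real.log ‖riemannXi ((1 / 2 : ℝ) : ℂ)‖ := ⟨_, rfl⟩
  obtain ⟨c, hc⟩ : ∃ c : ℕ → ℝ, ∀ m, c m = -((4 : ℝ) ^ m / m) * (∑' k, b k ^ m).re :=
    ⟨_, fun _ ↦ rfl⟩
  have hc0 : c 0 = 0 := by rw [hc]; simp
  obtain ⟨a, ha⟩ : ∃ a : ℕ → ℝ, ∀ j, a j = if j = 0 then L0 else if Even j then c (j / 2) else 0 :=
    ⟨_, fun _ ↦ rfl⟩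
  have ha0 : a 0 = L0 := by rw [ha, if_pos rfl]
  have ha2 : ∀ m, 1 ≤ m → a (2 * m) = c m := by
    intro m hm
    rw [ha, if_neg (by omega), if_pos (even_two_mul m), Nat.mul_div_cancel_left m two_pos]
  have hodd : ∀ j, ¬Even j → a j = 0 := by
    intro j hj
    have hj0 : j ≠ 0 := fun h ↦ hj (h ▸ Even.zero)
    rw [ha, if_neg hj0, if_neg hj]
  -- the radius `r = 1/(8(B+1))`
  obtain ⟨r, hr⟩ : ∃ r : ℝ, r = 1 / (8 * (B + 1)) := ⟨_, rfl⟩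
  have hr0 : 0 < r := by rw [hr]; positivity
  have hr1 : r ≤ 1 := by rw [hr, div_le_one (by positivity)]; linarith
  have hr2 : 4 * B * r ^ 2 ≤ 1 / 2 := by
    have h1 : r ^ 2 ≤ r := by nlinarith
    have h2 : 4 * B * r ≤ 1 / 2 := by
      rw [hr]
      rw [show 4 * B * (1 / (8 * (B + 1))) = B / (2 * (B + 1)) by field_simp; ring]
      rw [div_le_iff₀ (by positivity)]
      linarith
    nlinarith
  refine ⟨a, ENNReal.ofReal r, ⟨?_, by simpa using hr0, ?_⟩, fun m hm ↦ by rw [ha2 m hm, hc]⟩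
  · -- `r ≤ radius`: `‖aⱼ‖ rʲ ≤ max |L0| 1`
    have hnorm : ∀ j, ‖FormalMultilinearSeries.ofScalars ℝ a j‖ = |a j| := fun j ↦ by
      rw [FormalMultilinearSeries.ofScalars_norm_eq_mul, ContinuousMultilinearMap.norm_mkPiAlgebraFin,
        mul_one, Real.norm_eq_abs]
    have key : ∀ j, ‖FormalMultilinearSeries.ofScalars ℝ a j‖ * (r.toNNReal : ℝ) ^ j ≤ max |L0| 1 := by
      intro j
      rw [hnorm, Real.coe_toNNReal _ hr0.le]
      rcases Nat.eq_zero_or_pos j with rfl | hj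
      · rw [ha0, pow_zero, mul_one]; exact le_max_left _ _
      by_cases hev : Even j
      · obtain ⟨m, rfl⟩ := hev
        have hm : 1 ≤ m := by omega
        rw [← two_mul] at *
        rw [ha2 m hm, hc]
        have hR : |(∑' k, b k ^ m).re| ≤ B ^ m :=
          (abs_re_le_norm _).trans (hB ▸ (summable_pow_and_norm_tsum_pow_le hb hm).2)
        refine le_trans ?_ (le_max_right _ _)
        calc |-((4 : ℝ) ^ m / m) * (∑' k, b k ^ m).re| * r ^ (2 * m)
            = (4 : ℝ) ^ m / m * |(∑' k, b k ^ m).re| * r ^ (2 * m) := by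
              rw [abs_mul, abs_neg, abs_of_nonneg (by positivity)]
          _ ≤ (4 : ℝ) ^ m / m * B ^ m * r ^ (2 * m) := by gcongr
          _ ≤ (4 : ℝ) ^ m * B ^ m * r ^ (2 * m) := by
              gcongr
              exact div_le_self (by positivity) (by exact_mod_cast hm)
          _ = (4 * B * r ^ 2) ^ m := by rw [mul_pow, mul_pow, pow_mul]
          _ ≤ (1 / 2 : ℝ) ^ m := by gcongr
          _ ≤ 1 := pow_le_one₀ (by norm_num) (by norm_num)
      · rw [hodd j hev, abs_zero, zero_mul]
        exact le_trans zero_le_one (le_max_right _ _)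
    exact (FormalMultilinearSeries.ofScalars ℝ a).le_radius_of_bound _ key
  · -- the expansion on the ball
    intro y hy
    rw [Metric.eball_ofReal, Metric.mem_ball, dist_zero_right, Real.norm_eq_abs] at hy
    have hy' : 8 * ((∑' j, ‖b j‖) + 1) * y ^ 2 ≤ 1 := by
      rw [← hB]
      have h1 : y ^ 2 ≤ r ^ 2 := by
        rw [← sq_abs y]
        exact pow_le_pow_left₀ (abs_nonneg y) hy.le 2
      have h2 : r ^ 2 ≤ r := by nlinarith
      have h3 : 8 * (B + 1) * r = 1 := by rw [hr]; field_simp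
      nlinarith
    have hmain := (hasSum_log_norm_riemannXi_sub hb hy').neg
    rw [neg_neg] at hmain
    -- `∑_m c m y^{2m} = log|ξ(½+y)| − L0`
    have hc' : HasSum (fun m : ℕ ↦ c m * y ^ (2 * m))
        (Real.log ‖riemannXi ((1 / 2 + y : ℝ) : ℂ)‖ - L0) := by
      rw [hL0]
      refine hmain.congr_fun fun m ↦ ?_
      rw [hc, mul_pow, pow_mul]
      ring
    have h0 : HasSum (fun m : ℕ ↦ if m = 0 then L0 else 0) L0 := hasSum_ite_eq 0 L0
    have hsum := hc'.add h0
    rw [sub_add_cancel] at hsum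
    -- pass to the full series over `j = 2m`
    have hinj : Function.Injective fun m : ℕ ↦ 2 * m := fun m m' h ↦ by simpa using h
    have hzero : ∀ j ∉ Set.range (fun m : ℕ ↦ 2 * m), a j * y ^ j = 0 := by
      intro j hj
      have hev : ¬Even j := fun ⟨m, hm⟩ ↦ hj ⟨m, by simp only [hm, two_mul]⟩
      rw [hodd j hev, zero_mul]
    have hfull : HasSum (fun j : ℕ ↦ a j * y ^ j) (Real.log ‖riemannXi ((1 / 2 + y : ℝ) : ℂ)‖) := by
      refine (hinj.hasSum_iff hzero).1 (hsum.congr_fun fun m ↦ ?_)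
      simp only [Function.comp_apply]
      rcases Nat.eq_zero_or_pos m with rfl | hm
      · rw [mul_zero, ha0, hc0, pow_zero, if_pos rfl]; ring
      · rw [ha2 m hm, if_neg (by omega), add_zero]
    refine hfull.congr_fun fun j ↦ ?_
    rw [FormalMultilinearSeries.ofScalars_apply_eq, smul_eq_mul]

/-- **The even derivatives of `log|ξ|` at `½` as power sums over the Hadamard multiset**:
for every Hadamard sequence `b` of `H₀` and `n ≥ 1`,
`(log|ξ|)^{(2n)}(½) = −(2n)!·4ⁿ/n · Re ∑ₖ bₖⁿ`. -/
theorem iteratedDeriv_log_norm_riemannXi_one_half (hb : IsHadamardSeq 0 b) {n : ℕ} (hn : 1 ≤ n) :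
    iteratedDeriv (2 * n) (fun σ : ℝ ↦ Real.log ‖riemannXi (σ : ℂ)‖) (1 / 2) =
      -((2 * n)! * (4 : ℝ) ^ n / n) * (∑' k, b k ^ n).re := by
  obtain ⟨a, r, hp, ha⟩ := exists_hasFPowerSeriesOnBall_log_norm_riemannXi hb
  rw [iteratedDeriv_eq_iteratedFDeriv, ← hp.factorial_smul 1 (2 * n),
    FormalMultilinearSeries.ofScalars_apply_eq, ha n hn, one_pow, smul_eq_mul, mul_one, nsmul_eq_mul]
  ring

end Summit.RiemannHypothesis.LeeYang
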